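import Summits.QuantumFields.YangMills.Theorems.BalabanUVNodesN16Shape
import Summits.QuantumFields.YangMills.Theorems.BalabanUVNodesN16EndUniform
import HarnessLib

/-!
# Route «BalabanUVNodes» (cluster K4 «SpineRates»), Track-A DAG node N16 = NE3 — THE DECL OF RECORD `T4EtaRateMin.NE3Shape` KNIT FROM THE IN-EDGES:
# N05-interface ∧ N07-interface ∧ the data class ∧ ONE numeric regime ⟹ `NE3Shape` at Bałaban's minimiser readings over `sfClass 4 L N ε` (`d = 4`),
# with the regime PROVABLY inhabited and every binder live on the flat stratum

Cell `pub-ymgap`, seat `pub-ymgap-dag-n16-a` (KNIT-BY-NAME, HUMAN RULING D-0062; chair R424 venue; ROSTER-D0062 row n16 «DECL `T4EtaRateMin.NE3Shape`; record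
`NE3EnergyWeightedCovShape.NE3EnergyRateWCov`»), generation 2, file 3.  `bears_on: R4∕N16`.  Filed `--supports stmt-QuantumFields-19182` (`SpineGivenEndpoint`, K4).

THE COMPOSITION.  File 2 (`BalabanUVNodesN16EndUniform.n16_of_inEdges_uniform`): `∃ r > 0` (a function of `(L, N, n)` only) such that for every `g > 0`, leaf letters
`(b′, c′)` on their two lines, `0 < ε ≤ r`, `0 ≤ s₁ ≤ r`, `0 ≤ b ≤ ε∕2`: N05-interface `PairLandauGaugeB8Avg 4 (sfClass 4 L N ε) L N b g s₁ s₂ 1 dom` ∧ N07-interface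
`LeafH3sup 4 L N ε b′ c′ dom` ⟹ `∃ C, NE3EnergyRateWCov 4 (sfClass 4 L N ε) L N b g C s₁ s₂ dom` (N16's RECORD).  File 1 (`BalabanUVNodesN16Shape.ne3Shape_of_n16`): the
RECORD with letters `(b, gradConst 4 c)` ∧ `LeafH3sup 4 L N ε b c dom` ∧ data class `dom ⊆ sfClass 4 L N ε₁ 0` ∧ one numeral ⟹ the DECL `NE3Shape (minActReadings …) C′ (L⁻¹)`.
HERE the letters are MATCHED — leaf letters `(b′, c′) := (b, c)`, regularity letter `g := gradConst 4 c` (`c > 0`), class letter `b ≤ ε∕2` — which is possible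
because `r` comes FIRST: `ne3Shape_of_inEdges`.  The numeric regime (radii `b, c ≤ t`, `2^91·L^17·t ≤ 1`, `2^76·L^12·t ≤ ε`, `16·C₀(4)·ε ≤ 3`, `40960·L²·ε ≤ 1`,
`b ≤ ε∕2`, the `c`-line `23040·4⁴·(frameC 4 L + 4)³·(c + curConst·b²) ≤ 1`, data radius `ε₁ ≤ 1∕4`, `ε₁ ≤ b`, `4ε₁ ≤ c`) is INHABITED below every radius with
`ε, t, b, c, ε₁ > 0` (`knitRegime_exists`), and at such a point the flat stratum `FS_N ∋ 1` of the genuine class satisfies the data class and BOTH in-edge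
interfaces (g0's `pairLandauGaugeB8Avg_flatStratum`, `leafH3sup_flatStratum`; `inEdges_regime_inhabited`) — so no binder of the knit is vacuous and it is no
ex falso.

CONTENT (0 `def`, 0 `sorry`): `gradConst_four_pos`; **`ne3Shape_of_inEdges`** (THE KNIT of the DECL column); `knitRegime_exists`; `inEdges_regime_inhabited`.

HONEST FRAMING.  Typing∕bookkeeping over LANDED theorems by name; nothing of Bałaban's is asserted; the two in-edge interfaces are HYPOTHESIS SHAPES ([B8] Thm 2 +
(1.37) ∘ [B11] Thm 1 at the pairs; [B11] Thm 1 (8)+(10)) NOT proved on the lattice (census rows R4∕R5, XL); the (D) constant is crude (`∝ N⁴`); **N16 ∕ NE3 is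
NOT discharged** (count unchanged); NODE 00 has not pinned NE3's carriers `(L, N, ε, b, g, C, Λ₁, Λ₂′, dom)`; one finite four-torus at fixed ε — NOT ℝ⁴, NOT
infinite volume, NOT OS, NOT a mass gap, NOT Clay.
-/

set_option autoImplicit false

open scoped BigOperators Matrix Matrix.Norms.L2Operator
open NormedSpace Finset

namespace Summit.QuantumFields.YangMills.BalabanUVNodes.N16

open Literature.MathematicalPhysics.QuantumFieldTheory.Balaban1983to89
open B7Prop1Explicit B7Prop2Explicit
open T4AveragingDeficitWall hiding Site Plane Plaq Bond
open T4AveragingDeficitWallBoundary (IsPeriodicCfg periodBox)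
open T4EtaRateMin (NE3Shape)
open Summit.QuantumFields.BalabanUV.T4Continuum
open MinimalActionSandwich (IsMinimiser)
open MinimalActionRate (Regular sfClass minActReadings)
open MinimalActionRefine (RegularSup gradConst gradConst_nonneg)
open MinimalActionWitness (flatCfg)
open BlockAverageCurrent (curConst curConst_nonneg)
open NE3EnergyShapes (IsUnitarySite)
open NE3EnergyWeightedCovShape (NE3EnergyRateWCov)
open NE3RightInverseSupLetters (frameC)
open NE3.PairLandauB8Avg (PairLandauGaugeB8Avg)
open NE3.LeafIndexSockets (LeafH3sup)
open NE3.SupRegularityCurvedUniform (one_le_frameC_add)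
open NE7EtaBackgroundFlatStratum (flatCfg_mem_flatStratum)

noncomputable section

variable {n : Type*} [Fintype n] [DecidableEq n]

omit [Fintype n] [DecidableEq n] in
/-- `gradConst 4 c = 4·#Plane(4)·c² > 0` for `c > 0` (the plane type is inhabited by `(0, 1)`). [folklore] -/
theorem gradConst_four_pos {c : ℝ} (hc : 0 < c) : 0 < gradConst 4 c := by
  unfold gradConst
  have : 0 < (Fintype.card (T4AveragingDeficitWall.Plane 4) : ℝ) := by
    exact_mod_cast Fintype.card_pos_iff.2 ⟨(⟨((0 : Fin 4), (1 : Fin 4)), by decide⟩ : T4AveragingDeficitWall.Plane 4)⟩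
  positivity

/-! ## §1 THE KNIT OF THE DECL COLUMN: in-edge interfaces ∧ data class ∧ numeric regime ⟹ `NE3Shape` -/

/-- **N16 · THE ROW's DECL OF RECORD `T4EtaRateMin.NE3Shape` BY NAME FROM ITS IN-EDGES** (`d = 4`; block factor `L ≥ 2`, period `N ≥ 1`).  There is `r > 0`,
a function of `(L, N, n)` only, such that at every point of the numeric regime — class radius `0 < ε ≤ r`, B8 constant `0 ≤ s₁ ≤ r`, radii `0 ≤ b ≤ t`, `0 < c ≤ t`
with ONE numeral `2^91·L^17·t ≤ 1`, class-radius letter `2^76·L^12·t ≤ ε`, compactness `16·C₀(4)·ε ≤ 3`, `1024·5·8·L²·ε ≤ 1`, class letter `b ≤ ε∕2`, the `c`-line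
`23040·4⁴·(frameC 4 L + 4)³·(c + curConst 4 L·b²) ≤ 1`, data radius `ε₁ ≤ 1∕4`, `ε₁ ≤ b`, `4ε₁ ≤ c` — for every `s₂` and every datum set `dom ⊆ sfClass 4 L N ε₁ 0`:
the N05-interface `PairLandauGaugeB8Avg 4 (sfClass 4 L N ε) L N b (gradConst 4 c) s₁ s₂ 1 dom` ([Balaban1985RegularSpaces] Thm 2 (1.36)–(1.39) + (1.37), read at the
minimiser pair) and the N07-interface `LeafH3sup 4 L N ε b c dom` ([Balaban1985Variational] Thm 1 (8)+(10)) imply: (a) a selection `sel k V` of run-`k` minimisers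
over `sfClass 4 L N ε` with `RegularSup 4 L N b c k (sel k V)` EXISTS for the data of `dom`, and (b) for EVERY such selection there is `C′ ≥ 0` with
`NE3Shape (minActReadings 4 (sfClass 4 L N ε) L N dom loc_D) C′ (L⁻¹)` — `T4EtaRateMin.NE3Shape` BY NAME (`|A_{k+1}(V) − A_k(V)| ≤ C′(L⁻¹)^k N⁴`,
`|loc_D (k+1) V x − loc_D k V x| ≤ C′(L⁻¹)^k`, reading (D) `loc_D k V x = A_{B^k({x})}(sel k V)`).  Chain: file 2 `n16_of_inEdges_uniform` at `g := gradConst 4 c`,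
`(b′, c′) := (b, c)` ((Rb) from the numeral) → N16's RECORD `∃ C` (raised to `max C 0` by `NE3EnergyRateWCov.mono`) → file 1 `ne3Shape_of_n16`.
N16 ∕ NE3 is NOT proved: the two interfaces are the hypotheses. [folklore] -/
theorem ne3Shape_of_inEdges [Nonempty n] {L N : ℕ} (hL : 2 ≤ L) (hN : 1 ≤ N) :
    ∃ r : ℝ, 0 < r ∧ ∀ ⦃ε s₁ t b c ε₁ : ℝ⦄, 0 < ε → ε ≤ r → 0 ≤ s₁ → s₁ ≤ r →
      0 ≤ b → b ≤ t → 0 < c → c ≤ t →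
      (2 : ℝ) ^ 91 * (L : ℝ) ^ 17 * t ≤ 1 → (2 : ℝ) ^ 76 * (L : ℝ) ^ 12 * t ≤ ε →
      16 * C0 4 * ε ≤ 3 → 1024 * (4 + 1) * (4 + 4) * (L : ℝ) ^ 2 * ε ≤ 1 → b ≤ ε / 2 →
      23040 * (4 : ℝ) ^ 4 * (frameC 4 L + 4) ^ 3 * (c + curConst 4 L * b ^ 2) ≤ 1 →
      ε₁ ≤ 1 / 4 → ε₁ ≤ b → 4 * ε₁ ≤ c →
      ∀ (s₂ : ℝ) {dom : Set (Site 4 → Fin 4 → (Matrix n n ℂ)ˣ)}, dom ⊆ sfClass 4 L N ε₁ 0 →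
        PairLandauGaugeB8Avg 4 (sfClass 4 L N ε) L N b (gradConst 4 c) s₁ s₂ 1 dom →
        LeafH3sup 4 L N ε b c dom →
        (∃ sel : ℕ → (Site 4 → Fin 4 → (Matrix n n ℂ)ˣ) → (Site 4 → Fin 4 → (Matrix n n ℂ)ˣ),
            ∀ V ∈ dom, ∀ k : ℕ, IsMinimiser 4 (sfClass 4 L N ε) L N k V (sel k V) ∧ RegularSup 4 L N b c k (sel k V)) ∧
        ∀ sel : ℕ → (Site 4 → Fin 4 → (Matrix n n ℂ)ˣ) → (Site 4 → Fin 4 → (Matrix n n ℂ)ˣ),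
          (∀ V ∈ dom, ∀ k : ℕ, IsMinimiser 4 (sfClass 4 L N ε) L N k V (sel k V)) →
          (∀ V ∈ dom, ∀ k : ℕ, RegularSup 4 L N b c k (sel k V)) →
          ∃ C' : ℝ, 0 ≤ C' ∧
            NE3Shape
              (minActReadings 4 (sfClass 4 L N ε) L N dom
                (fun k V (x : ↥(periodBox (d := 4) N)) =>
                  fineAction (sel k V) (((blockSites L)^[k] {(x : Site 4)}) ×ˢ Finset.univ)))
              C' ((L : ℝ)⁻¹) := by
  obtain ⟨r, hr0, hr⟩ := n16_of_inEdges_uniform (n := n) hL hN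
  refine ⟨r, hr0, fun ε s₁ t b c ε₁ hε hεr hs₁ hs₁r hb hbt hc hct hsmall hεt hε1 hε2 hbε hcF hε₁ hε₁b hε₁c s₂ dom hdom hB8 h3 => ?_⟩
  have hL1 : (1 : ℝ) ≤ L := by exact_mod_cast (show 1 ≤ L by omega)
  -- the leaf line (Rb) at `b′ := b` from the numeral: `2¹⁵·5²·8²·L² ≤ 2^91·L^17`
  have hRb : 2 ^ 15 * ((4 : ℝ) + 1) ^ 2 * ((4 : ℝ) + 4) ^ 2 * (L : ℝ) ^ 2 * b ≤ 1 := by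
    have h2 : (L : ℝ) ^ 2 ≤ (L : ℝ) ^ 17 := pow_le_pow_right₀ hL1 (by norm_num)
    have e : 2 ^ 15 * ((4 : ℝ) + 1) ^ 2 * ((4 : ℝ) + 4) ^ 2 * (L : ℝ) ^ 2 * b = 52428800 * ((L : ℝ) ^ 2 * b) := by ring
    rw [e]
    have h5 : (L : ℝ) ^ 2 * b ≤ (L : ℝ) ^ 17 * t := mul_le_mul h2 hbt hb (by positivity)
    have h6 : (2 : ℝ) ^ 91 * ((L : ℝ) ^ 17 * t) ≤ 1 := by linarith [hsmall]
    have h7 : 0 ≤ (L : ℝ) ^ 17 * t := le_trans (by positivity) h5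
    linarith [h5, h6, h7]
  -- N16's RECORD from the in-edges (file 2), letters matched: `g := gradConst 4 c`, `(b′, c′) := (b, c)`
  obtain ⟨C, h16⟩ := hr (gradConst_four_pos hc) hb hc.le hRb hcF hε hεr hs₁ hs₁r hb hbε s₂ hB8 h3
  -- the DECL from the RECORD (file 1), constant raised to `max C 0 ≥ 0`
  exact ne3Shape_of_n16 hL hN hb hc.le hbt hct (le_max_right C 0) hsmall hεt hε1 hε2 hε₁ hε₁b hε₁c hdom
    (h16.mono (le_max_left C 0) le_rfl le_rfl) h3

/-! ## §2 VACUITY GUARD: the regime is inhabited below every radius; at such a point every binder is live on the flat stratum -/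

omit [Fintype n] [DecidableEq n] in
/-- **THE NUMERIC REGIME OF THE KNIT IS INHABITED BELOW EVERY RADIUS** (`L ≥ 1`, any `r > 0`): there are `ε, t, b, c, ε₁ > 0` with `ε ≤ r`, `b, c ≤ t`,
`2^91·L^17·t ≤ 1`, `2^76·L^12·t ≤ ε`, `16·C₀(4)·ε ≤ 3`, `1024·5·8·L²·ε ≤ 1`, `b ≤ ε∕2`, `23040·4⁴·(frameC 4 L + 4)³·(c + curConst 4 L·b²) ≤ 1`, `ε₁ ≤ 1∕4`,
`ε₁ ≤ b`, `4ε₁ ≤ c` — file 1's `shapeRegime_exists` for `(ε, t)`, then `b = c = τ := min t τ₀`, `τ₀ = (23040·4⁴·(frameC 4 L + 4)³·(1 + curConst 4 L))⁻¹`, `ε₁ = τ∕4`.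
Elementary. [folklore] -/
theorem knitRegime_exists {L : ℕ} (hL : 1 ≤ L) {r : ℝ} (hr : 0 < r) :
    ∃ ε t b c ε₁ : ℝ, 0 < ε ∧ ε ≤ r ∧ 0 < t ∧ 0 < b ∧ b ≤ t ∧ 0 < c ∧ c ≤ t ∧
      (2 : ℝ) ^ 91 * (L : ℝ) ^ 17 * t ≤ 1 ∧ (2 : ℝ) ^ 76 * (L : ℝ) ^ 12 * t ≤ ε ∧
      16 * C0 4 * ε ≤ 3 ∧ 1024 * (4 + 1) * (4 + 4) * (L : ℝ) ^ 2 * ε ≤ 1 ∧ b ≤ ε / 2 ∧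
      23040 * (4 : ℝ) ^ 4 * (frameC 4 L + 4) ^ 3 * (c + curConst 4 L * b ^ 2) ≤ 1 ∧
      0 < ε₁ ∧ ε₁ ≤ 1 / 4 ∧ ε₁ ≤ b ∧ 4 * ε₁ ≤ c := by
  obtain ⟨ε, t, -, hε0, hεr, ht0, -, ht1, ht2, hε1, hε2, -, -, -, htε⟩ := shapeRegime_exists hL hr
  -- the `c`-line cut
  have hF1 : (1 : ℝ) ≤ frameC 4 L + 4 := by
    have := one_le_frameC_add (d := 4) (by norm_num) L
    push_cast at this
    exact this
  have hcur : 0 ≤ curConst 4 L := curConst_nonneg (d := 4) L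
  set A : ℝ := 23040 * (4 : ℝ) ^ 4 * (frameC 4 L + 4) ^ 3 * (1 + curConst 4 L) with hA
  have hF0 : 0 ≤ frameC 4 L + 4 := le_trans zero_le_one hF1
  have hA1 : 1 ≤ A := by
    have h3 : (1 : ℝ) ≤ (frameC 4 L + 4) ^ 3 := one_le_pow₀ hF1
    calc (1 : ℝ) ≤ (frameC 4 L + 4) ^ 3 := h3
      _ ≤ (frameC 4 L + 4) ^ 3 * (1 + curConst 4 L) := le_mul_of_one_le_right (by positivity) (by linarith)
      _ ≤ 23040 * (4 : ℝ) ^ 4 * ((frameC 4 L + 4) ^ 3 * (1 + curConst 4 L)) := le_mul_of_one_le_left (by positivity) (by norm_num)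
      _ = A := by rw [hA]; ring
  have hA0 : 0 < A := by linarith
  set τ : ℝ := min t (1 / A) with hτ
  have hτ0 : 0 < τ := lt_min ht0 (by positivity)
  have hτt : τ ≤ t := min_le_left _ _
  have hτA : τ ≤ 1 / A := min_le_right _ _
  have hτ1 : τ ≤ 1 := hτA.trans (by rw [div_le_one hA0]; exact hA1)
  have hline : 23040 * (4 : ℝ) ^ 4 * (frameC 4 L + 4) ^ 3 * (τ + curConst 4 L * τ ^ 2) ≤ 1 := by
    have hτ2 : τ ^ 2 ≤ τ := by nlinarith
    have h1 : τ + curConst 4 L * τ ^ 2 ≤ τ * (1 + curConst 4 L) := by nlinarith [mul_le_mul_of_nonneg_left hτ2 hcur]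
    have h2 : 0 ≤ 23040 * (4 : ℝ) ^ 4 * (frameC 4 L + 4) ^ 3 := by positivity
    have hb2 : 0 ≤ τ * (1 + curConst 4 L) := by positivity
    calc 23040 * (4 : ℝ) ^ 4 * (frameC 4 L + 4) ^ 3 * (τ + curConst 4 L * τ ^ 2)
        ≤ 23040 * (4 : ℝ) ^ 4 * (frameC 4 L + 4) ^ 3 * (τ * (1 + curConst 4 L)) := mul_le_mul_of_nonneg_left h1 h2
      _ = A * τ := by rw [hA]; ring
      _ ≤ A * (1 / A) := mul_le_mul_of_nonneg_left hτA hA0.le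
      _ = 1 := by field_simp
  refine ⟨ε, t, τ, τ, τ / 4, hε0, hεr, ht0, hτ0, hτt, hτ0, hτt, ht1, ht2, hε1, hε2, hτt.trans htε, hline, by positivity, ?_, by linarith,
    by linarith⟩
  linarith

/-- **NO BINDER OF THE KNIT IS VACUOUS** (`L ≥ 2`, `N ≥ 1`): with `r` the radius of `ne3Shape_of_inEdges`, there is a regime point `(ε, s₁, t, b, c, ε₁)` satisfying
ALL its numeric side conditions (`knitRegime_exists`, `s₁ = 0`) at which, on the flat stratum `FS_N = {v N-periodic | ∃ w unitary, v = 1^{w}}` of the genuine class,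
the data class holds (`flatStratum_subset_sfClass_zero`), the datum set is NON-EMPTY (`1 ∈ FS_N`), the N05-interface holds with the matched letters
`(b, gradConst 4 c, s₁, s₂ = 0)` (g0's `pairLandauGaugeB8Avg_flatStratum`, `Z = 0`) and the N07-interface holds (g0's `leafH3sup_flatStratum`) — so the knit
APPLIES there and its hypotheses are jointly satisfiable together with its conclusion on ONE class family. [folklore] -/
theorem inEdges_regime_inhabited [Nonempty n] {L N : ℕ} (hL : 2 ≤ L) (hN : 1 ≤ N) {r : ℝ} (hr : 0 < r) :
    ∃ ε s₁ t b c ε₁ : ℝ, 0 < ε ∧ ε ≤ r ∧ 0 ≤ s₁ ∧ s₁ ≤ r ∧ 0 ≤ b ∧ b ≤ t ∧ 0 < c ∧ c ≤ t ∧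
      (2 : ℝ) ^ 91 * (L : ℝ) ^ 17 * t ≤ 1 ∧ (2 : ℝ) ^ 76 * (L : ℝ) ^ 12 * t ≤ ε ∧
      16 * C0 4 * ε ≤ 3 ∧ 1024 * (4 + 1) * (4 + 4) * (L : ℝ) ^ 2 * ε ≤ 1 ∧ b ≤ ε / 2 ∧
      23040 * (4 : ℝ) ^ 4 * (frameC 4 L + 4) ^ 3 * (c + curConst 4 L * b ^ 2) ≤ 1 ∧
      ε₁ ≤ 1 / 4 ∧ ε₁ ≤ b ∧ 4 * ε₁ ≤ c ∧ 0 < ε₁ ∧ 0 < b ∧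
      {v : Site 4 → Fin 4 → (Matrix n n ℂ)ˣ | IsPeriodicCfg v (N : ℤ) ∧ ∃ w : Site 4 → (Matrix n n ℂ)ˣ,
          IsUnitarySite w ∧ v = gaugeAct w flatCfg} ⊆ sfClass 4 L N ε₁ 0 ∧
      (flatCfg : Site 4 → Fin 4 → (Matrix n n ℂ)ˣ) ∈ {v : Site 4 → Fin 4 → (Matrix n n ℂ)ˣ | IsPeriodicCfg v (N : ℤ) ∧
          ∃ w : Site 4 → (Matrix n n ℂ)ˣ, IsUnitarySite w ∧ v = gaugeAct w flatCfg} ∧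
      PairLandauGaugeB8Avg 4 (sfClass 4 L N ε) L N b (gradConst 4 c) s₁ 0 1
        {v : Site 4 → Fin 4 → (Matrix n n ℂ)ˣ | IsPeriodicCfg v (N : ℤ) ∧ ∃ w : Site 4 → (Matrix n n ℂ)ˣ,
          IsUnitarySite w ∧ v = gaugeAct w flatCfg} ∧
      LeafH3sup 4 L N ε b c
        {v : Site 4 → Fin 4 → (Matrix n n ℂ)ˣ | IsPeriodicCfg v (N : ℤ) ∧ ∃ w : Site 4 → (Matrix n n ℂ)ˣ,
          IsUnitarySite w ∧ v = gaugeAct w flatCfg} := by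
  have hL1 : 1 ≤ L := le_trans (by norm_num) hL
  obtain ⟨ε, t, b, c, ε₁, hε0, hεr, ht0, hb0, hbt, hc0, hct, ht1, ht2, hε1, hε2, hbε, hline, hε₁0, hε₁, hε₁b, hε₁c⟩ :=
    knitRegime_exists hL1 hr
  exact ⟨ε, 0, t, b, c, ε₁, hε0, hεr, le_rfl, hr.le, hb0.le, hbt, hc0, hct, ht1, ht2, hε1, hε2, hbε, hline, hε₁, hε₁b, hε₁c, hε₁0, hb0,
    flatStratum_subset_sfClass_zero L N hε₁0.le, flatCfg_mem_flatStratum N,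
    pairLandauGaugeB8Avg_flatStratum hL1 hN hε0.le b (gradConst 4 c) 1 le_rfl le_rfl, leafH3sup_flatStratum hL1 hN hε0.le hb0.le hc0.le⟩

end

end Summit.QuantumFields.YangMills.BalabanUVNodes.N16
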